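import Summits.BirchSwinnertonDyer.Rank1Residual.Additive.DictionaryUniform
import Literature.NumberTheory.EllipticCurves.RootNumberProofs
import Literature.NumberTheory.DiophantineGeometry.TateAlgorithmAdditiveProofs
import Literature.NumberTheory.DiophantineGeometry.TateAlgorithmProofs
import Literature.NumberTheory.DiophantineGeometry.MinimalDiscriminantFactorizationProofs
import Literature.NumberTheory.DiophantineGeometry.EllArithGlueProofs
import HarnessLib

/-!
# X3/X4 at an additive prime `p ≥ 5`: the Kodaira symbol read off `ord_p Δ_min` (types II, III, IV =
# the unstarred potentially good types, `ord_p Δ_min ≤ 4`)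

HONEST FRAMING (cell `b2b-bsdres`, run/shared/lean/b2b/bsd-rank1-residual/, verbatim in every
file): the goal of the cell is to DELETE the COMBINATION-SHAPED residual classes of the
Birch–Swinnerton-Dyer formula for ALL analytic-rank `≤ 1` elliptic curves over `ℚ` — "full BSD
formula for every rank `≤ 1` curve in class `C`" assembled STRICTLY from published theorems — so
that the rank-`≤ 1` remainder becomes exactly the CONSTRUCTION-SHAPED classes, which are TYPED
(missing-input `Prop`s), NOT attempted. This is not "finishing BSD". Sub-cell `additive-p2`
(CLASS-OWNERS row "X3/X4 additive — pot. good ordinary / X3♯(G-ord)"), generation 14: research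
route; no claim beyond the stated classes; theorems only, no definition, no new named fact;
X3♯(G-ord)/X4♯(G-ord) stay CONSTRUCTION-SHAPED; no label moves; nothing is booked.

WHAT THIS FILE DOES (dictionary; consumer `Additive/GordManinConstant.lean` — the Kodaira-type
half of Edixhoven 1991 Thm. 3 on the Manin constant is stated in terms of the types II, III, IV).
At an ADDITIVE prime `p ≥ 5` of `E/ℚ` (`Addv W p`, `W` globally minimal), at the place
`placeOf p` of `ℤ` (`SharpenedStatements.lean`): `f_p = 2` (gen 9's
`condExpTwo_of_addv_of_five_le`, Silverman *ATAEC* IV.10.4) and Ogg's formula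
`f_v = ord_v Δ_min + 1 − m_v` — the tree's DEFINITION of `WeierstrassCurve.conductorExponent` —
give `ord_p Δ_min = m_p + 1` (`padicValInt_minimalDiscriminantInt_eq_numComponents_add_one`),
so by Table 4.1 the Kodaira symbol and `ord_p Δ_min` determine each other on the seven additive
types: `kodairaSymbolAt_placeOf_cases_of_addv` (II ↦ 2, III ↦ 3, IV ↦ 4, Iₙ* ↦ n + 6, IV* ↦ 8,
III* ↦ 9, II* ↦ 10), the three iffs `kodairaSymbolAt_placeOf_eq_II_iff_of_addv` / `…III…` /
`…IV…`, and **`kodairaSymbolAt_placeOf_II_or_III_or_IV_iff_of_addv`: type II/III/IV ⟺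
`ord_p Δ_min ≤ 4`** (the unstarred potentially good types; semistability defect
`e = 12/gcd(12, ord_p Δ_min) = 6, 4, 3`); the starred types and `I₀*` have `ord_p Δ_min ≥ 6`
(`Addv.four_lt_padicValInt_of_semistabilityIndex_dvd_two`: defect `∣ 2` ⟹ `ord_p Δ_min > 4`).
Bridges used: `ordMinimalDiscriminant_placeOf_eq` (place exponent = `padicValInt`),
`isAdditive_kodairaSymbolAt_placeOf_of_addv` (the cell's `Addv` ⟹ an additive symbol, via the
tree's prime/place reduction bridges and Tate's algorithm facts `isGood_kodairaSymbolAt_iff`,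
`kodairaSymbolAt_eq_I_iff`). Census use: the bit `v_p(Δ_min) ≤ 4` (hyp `vD`) is the Kodaira
bit "II/III/IV" at every additive `p ≥ 5`. Nothing here changes a label.

References: J. H. Silverman, *ATAEC* IV.9.4 Table 4.1, IV.10.4, IV.11.1 (Ogg's formula);
A. P. Ogg, Amer. J. Math. 89 (1967); J. H. Silverman, *AEC* VII.5 Prop. 5.1, VIII.8.
-/

noncomputable section

open scoped Classical NumberField

open WeierstrassCurve IsDedekindDomain IsDedekindDomain.HeightOneSpectrum NumberField
  Rat.HeightOneSpectrum Literature.NumberTheory.EllipticCurves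
  Literature.NumberTheory.EllipticCurves.Rank1Residual
  Literature.NumberTheory.DiophantineGeometry

namespace Summit.BirchSwinnertonDyer.Rank1Residual.Additive

variable (W : WeierstrassCurve ℚ) [W.IsElliptic] [W.IsGloballyMinimal] (p : ℕ) [hp : Fact p.Prime]

/-! ### §1 The Kodaira symbol at an additive `p ≥ 5`, read off `ord_p Δ_min` -/

/-- `ord_{(p)} Δ_min = ord_p Δ_min(E)`: the place-indexed exponent at the place `(p)` of `ℤ` is the
`p`-adic valuation of the minimal discriminant (both are the `p`-adic exponent;
`factorization_minimalDiscriminantNorm_holds`, `minimalDiscriminantNorm_int_eq_natAbs_…`).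
[cite: SilvermanAEC2009, VIII.8 (minimal discriminant)] -/
theorem ordMinimalDiscriminant_placeOf_eq :
    W.ordMinimalDiscriminant (placeOf p) = padicValInt p W.minimalDiscriminantInt := by
  have hgen : natGenerator (placeOf p) = p :=
    congrArg Subtype.val ((primesEquiv (R := ℤ)).apply_symm_apply ⟨p, hp.out⟩)
  have h1 := W.factorization_minimalDiscriminantNorm_holds (placeOf p)
  rw [hgen, minimalDiscriminantNorm_int_eq_natAbs_minimalDiscriminantInt_holds W,
    Nat.factorization_def _ hp.out] at h1
  rw [← h1]
  rfl

omit [W.IsGloballyMinimal] in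
/-- **An additive `p` gives an additive Kodaira symbol at the place `(p)` of `ℤ`** (`Addv W p` =
"neither good nor multiplicative `ℤ_[p]`-minimal model"; the tree's prime/place bridges
`hasGoodReductionAtPrime_iff_hasGoodReductionAt_holds`,
`hasMultiplicativeReductionAtPrime_iff_hasMultiplicativeReductionAt_holds`, and Tate's algorithm
`isGood_kodairaSymbolAt_iff_holds` / `kodairaSymbolAt_eq_I_iff_holds`).
[cite: SilvermanAEC2009, VII.5 Prop. 5.1] -/
theorem isAdditive_kodairaSymbolAt_placeOf_of_addv (hadd : Addv W p) :
    (W.kodairaSymbolAt (placeOf p)).IsAdditive := by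
  refine ⟨fun hg ↦ hadd.1 ?_, fun hm ↦ hadd.2 ?_⟩
  · exact (W.hasGoodReductionAtPrime_iff_hasGoodReductionAt_holds ⟨p, hp.out⟩).mpr
      ((isGood_kodairaSymbolAt_iff_holds (placeOf p) W).mp hg)
  · obtain ⟨n, hn, hk⟩ := hm
    exact (W.hasMultiplicativeReductionAtPrime_iff_hasMultiplicativeReductionAt_holds ⟨p, hp.out⟩).mpr
      ((kodairaSymbolAt_eq_I_iff_holds (placeOf p) W hn).mp hk).1

/-- **Ogg at an additive `p ≥ 5`: `ord_p Δ_min = m_p + 1`** (`f_p = 2`, gen 9's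
`condExpTwo_of_addv_of_five_le`; `f_v = ord_v Δ_min + 1 − m_v` is the tree's definition of
`conductorExponent`). [cite: SilvermanATAEC1994, IV.10.4 and IV.11.1] -/
theorem padicValInt_minimalDiscriminantInt_eq_numComponents_add_one (hp5 : 5 ≤ p)
    (hadd : Addv W p) :
    padicValInt p W.minimalDiscriminantInt = (W.kodairaSymbolAt (placeOf p)).numComponents + 1 := by
  have hf : W.conductorExponent (placeOf p) = 2 := condExpTwo_of_addv_of_five_le W p hp5 hadd
  unfold WeierstrassCurve.conductorExponent WeierstrassCurve.numComponentsAt at hf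
  rw [← ordMinimalDiscriminant_placeOf_eq]
  omega

/-- **The seven additive Kodaira types at an additive `p ≥ 5`, with `ord_p Δ_min = m_p + 1`**:
`II ↦ 2`, `III ↦ 3`, `IV ↦ 4`, `Iₙ* ↦ n + 6`, `IV* ↦ 8`, `III* ↦ 9`, `II* ↦ 10`
(Silverman *ATAEC* IV Table 4.1; `I₀`, `Iₙ` excluded by additivity).
[cite: SilvermanATAEC1994, IV Table 4.1 (PDF p. 365)] -/
theorem kodairaSymbolAt_placeOf_cases_of_addv (hp5 : 5 ≤ p) (hadd : Addv W p) :
    (W.kodairaSymbolAt (placeOf p) = .II ∧ padicValInt p W.minimalDiscriminantInt = 2) ∨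
    (W.kodairaSymbolAt (placeOf p) = .III ∧ padicValInt p W.minimalDiscriminantInt = 3) ∨
    (W.kodairaSymbolAt (placeOf p) = .IV ∧ padicValInt p W.minimalDiscriminantInt = 4) ∨
    (∃ n : ℕ, W.kodairaSymbolAt (placeOf p) = .Istar n ∧
      padicValInt p W.minimalDiscriminantInt = n + 6) ∨
    (W.kodairaSymbolAt (placeOf p) = .IVstar ∧ padicValInt p W.minimalDiscriminantInt = 8) ∨
    (W.kodairaSymbolAt (placeOf p) = .IIIstar ∧ padicValInt p W.minimalDiscriminantInt = 9) ∨
    (W.kodairaSymbolAt (placeOf p) = .IIstar ∧ padicValInt p W.minimalDiscriminantInt = 10) := by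
  have hk := isAdditive_kodairaSymbolAt_placeOf_of_addv W p hadd
  have hv := padicValInt_minimalDiscriminantInt_eq_numComponents_add_one W p hp5 hadd
  rcases hks : W.kodairaSymbolAt (placeOf p) with (_ | n) | _ | _ | _ | n | _ | _ | _ <;>
    rw [hks] at hk hv <;> simp only [KodairaSymbol.numComponents] at hv
  · exact absurd rfl hk.1
  · exact absurd ⟨_, Nat.succ_ne_zero _, rfl⟩ hk.2
  · exact Or.inl ⟨rfl, hv⟩
  · exact Or.inr (Or.inl ⟨rfl, hv⟩)
  · exact Or.inr (Or.inr (Or.inl ⟨rfl, hv⟩))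
  · exact Or.inr (Or.inr (Or.inr (Or.inl ⟨n, rfl, by omega⟩)))
  · exact Or.inr (Or.inr (Or.inr (Or.inr (Or.inl ⟨rfl, hv⟩))))
  · exact Or.inr (Or.inr (Or.inr (Or.inr (Or.inr (Or.inl ⟨rfl, hv⟩)))))
  · exact Or.inr (Or.inr (Or.inr (Or.inr (Or.inr (Or.inr ⟨rfl, hv⟩)))))

/-- **Kodaira type II ⟺ `ord_p Δ_min = 2`** at an additive `p ≥ 5` (Table 4.1: `m(II) = 1`; the
other symbols with one component, `I₀`, `I₁`, are not additive).
[cite: SilvermanATAEC1994, IV Table 4.1 (PDF p. 365)] -/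
theorem kodairaSymbolAt_placeOf_eq_II_iff_of_addv (hp5 : 5 ≤ p) (hadd : Addv W p) :
    W.kodairaSymbolAt (placeOf p) = .II ↔ padicValInt p W.minimalDiscriminantInt = 2 := by
  rcases kodairaSymbolAt_placeOf_cases_of_addv W p hp5 hadd with
    ⟨hk, hv⟩ | ⟨hk, hv⟩ | ⟨hk, hv⟩ | ⟨n, hk, hv⟩ | ⟨hk, hv⟩ | ⟨hk, hv⟩ | ⟨hk, hv⟩ <;> simp [hk, hv]

/-- **Kodaira type III ⟺ `ord_p Δ_min = 3`** at an additive `p ≥ 5` (`m(III) = 2`).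
[cite: SilvermanATAEC1994, IV Table 4.1 (PDF p. 365)] -/
theorem kodairaSymbolAt_placeOf_eq_III_iff_of_addv (hp5 : 5 ≤ p) (hadd : Addv W p) :
    W.kodairaSymbolAt (placeOf p) = .III ↔ padicValInt p W.minimalDiscriminantInt = 3 := by
  rcases kodairaSymbolAt_placeOf_cases_of_addv W p hp5 hadd with
    ⟨hk, hv⟩ | ⟨hk, hv⟩ | ⟨hk, hv⟩ | ⟨n, hk, hv⟩ | ⟨hk, hv⟩ | ⟨hk, hv⟩ | ⟨hk, hv⟩ <;> simp [hk, hv]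

/-- **Kodaira type IV ⟺ `ord_p Δ_min = 4`** at an additive `p ≥ 5` (`m(IV) = 3`).
[cite: SilvermanATAEC1994, IV Table 4.1 (PDF p. 365)] -/
theorem kodairaSymbolAt_placeOf_eq_IV_iff_of_addv (hp5 : 5 ≤ p) (hadd : Addv W p) :
    W.kodairaSymbolAt (placeOf p) = .IV ↔ padicValInt p W.minimalDiscriminantInt = 4 := by
  rcases kodairaSymbolAt_placeOf_cases_of_addv W p hp5 hadd with
    ⟨hk, hv⟩ | ⟨hk, hv⟩ | ⟨hk, hv⟩ | ⟨n, hk, hv⟩ | ⟨hk, hv⟩ | ⟨hk, hv⟩ | ⟨hk, hv⟩ <;> simp [hk, hv]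

/-- **The unstarred types: Kodaira II, III or IV ⟺ `ord_p Δ_min ≤ 4`** at an additive `p ≥ 5`
(the additive symbols have `m_p ∈ {1, 2, 3, 5 + n, 7, 8, 9}`, so `ord_p Δ_min = m_p + 1 ∈
{2, 3, 4} ∪ {6 + n, 8, 9, 10}`). [cite: SilvermanATAEC1994, IV Table 4.1 (PDF p. 365)] -/
theorem kodairaSymbolAt_placeOf_II_or_III_or_IV_iff_of_addv (hp5 : 5 ≤ p) (hadd : Addv W p) :
    (W.kodairaSymbolAt (placeOf p) = .II ∨ W.kodairaSymbolAt (placeOf p) = .III ∨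
        W.kodairaSymbolAt (placeOf p) = .IV) ↔
      padicValInt p W.minimalDiscriminantInt ≤ 4 := by
  rcases kodairaSymbolAt_placeOf_cases_of_addv W p hp5 hadd with
    ⟨hk, hv⟩ | ⟨hk, hv⟩ | ⟨hk, hv⟩ | ⟨n, hk, hv⟩ | ⟨hk, hv⟩ | ⟨hk, hv⟩ | ⟨hk, hv⟩ <;> simp [hk, hv]

/-- **The starred types have `ord_p Δ_min ≥ 6`; in particular semistability defect `2`
(`semistabilityIndex W p ∣ 2 ⟺ 6 ∣ ord_p Δ_min`, gen 4) puts an additive pair OUTSIDE the types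
II/III/IV: `4 < ord_p Δ_min`.** [cite: SilvermanATAEC1994, IV Table 4.1 (PDF p. 365)] -/
theorem Addv.four_lt_padicValInt_of_semistabilityIndex_dvd_two (hp5 : 5 ≤ p) (hadd : Addv W p)
    (he : semistabilityIndex W p ∣ 2) : 4 < padicValInt p W.minimalDiscriminantInt := by
  have h6 : 6 ∣ padicValInt p W.minimalDiscriminantInt :=
    (semistabilityIndex_dvd_two_iff W p).mp he
  have hv := padicValInt_minimalDiscriminantInt_eq_numComponents_add_one W p hp5 hadd
  omega

end Summit.BirchSwinnertonDyer.Rank1Residual.Additive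

end
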